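import Mathlib

/-!
# `OrigamiRung` — negative-side support: the arithmetic core of the rung and its tightness

Crux `SymplecticOrigami.OrigamiRung` (item stmt-SmoothPoincare4-7843), cdisprove seat.
Pure arithmetic / finite-group facts isolating the numerical skeleton of the rung's proof plan
(Betti pinch → piece rigidity → genus table), for provers to import, and recording its TIGHTNESS:
the door tuple solves every numerical constraint, so the escape clause
`∀ i, (b₁, b₂)(N i) = (2, 1)` of the crux cannot be removed by bookkeeping alone.

* `bettiPinch`: χ-count + Mayer–Vietoris bound + `b₂ ≥ 1` ⇒ `b₂ = 1` on both pieces and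
  `b₁(N₀) + b₁(N₁) = 2g`.
* `no_isotropic_pinch`: the Euler-number-zero branch has no solution (parity).
* `genusTable`: adjunction bookkeeping with BOTH signs of `K` allowed on each piece — only
  `g = 0` with two `b₁ = 0` pieces (`m ∈ {1, 2}`: line / conic) or `g = 2` with two `b₁ = 2`
  pieces survive; `g = 1` dies on the shared `m`.
* `door_is_solution`: the door invariants are consistent (tightness of the disjunction).
* `conic_case_excluded`: `ℤ/4` does not surject onto `ℤ/2 ⊕ ℤ/2` (kills the conic ⊔ conic fold
  of a homology sphere).
-/

-- the prescribed namespace `Summit.<P>.<Sub>.…` duplicates `SmoothPoincare4` (P = Sub)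
set_option linter.dupNamespace false

namespace Summit.SmoothPoincare4.SmoothPoincare4.Theorems.OrigamiRung.Negative

/-- **Betti pinch (arithmetic).**  Write `aᵢ = b₁(Nᵢ)`, `cᵢ = b₂(Nᵢ)`, `g` = genus of the
collapsed fold `B`.  Topological inputs of the rung: `χ(N₀) + χ(N₁) = χ(M) + 2χ(B) = 6 − 4g`
(`hχ`, with `χ(Nᵢ) = 2 − 2aᵢ + cᵢ` by Poincaré duality), the Mayer–Vietoris surjection
`H₁(Z) ↠ H₁(W₀) ⊕ H₁(W₁) ↠ H₁(N₀) ⊕ H₁(N₁)` with `b₁(Z) = 2g` when the Euler number `e ≠ 0`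
(`hMV`), and `cᵢ ≥ 1` because `[s i]² > 0`.  Output: both pieces have `b₂ = 1` and the first
Betti numbers add up to `2g` exactly. [folklore] -/
theorem bettiPinch (g a₀ a₁ c₀ c₁ : ℕ)
    (hχ : ((2 : ℤ) - 2 * a₀ + c₀) + (2 - 2 * a₁ + c₁) = 6 - 4 * g)
    (hMV : a₀ + a₁ ≤ 2 * g) (h₀ : 1 ≤ c₀) (h₁ : 1 ≤ c₁) :
    c₀ = 1 ∧ c₁ = 1 ∧ a₀ + a₁ = 2 * g := by
  omega

/-- **The isotropic branch `e = 0` dies (arithmetic).**  If the Euler number of `Z → B` vanished,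
`b₁(Z) = 2g + 1` (`hMV`), each piece would contain a non-zero isotropic class `[Bᵢ]`, forcing
`cᵢ ≥ 2` and (unimodularity + `[s]² > 0`) `b⁺ = b⁻ = 1`, whence `aᵢ` even by the almost-complex
parity `1 − b₁ + b⁺ ≡ 0 (mod 2)`; the χ-count then has no solution. [folklore] -/
theorem no_isotropic_pinch (g a₀ a₁ c₀ c₁ : ℕ)
    (hχ : ((2 : ℤ) - 2 * a₀ + c₀) + (2 - 2 * a₁ + c₁) = 6 - 4 * g)
    (hMV : a₀ + a₁ ≤ 2 * g + 1) (h₀ : 2 ≤ c₀) (h₁ : 2 ≤ c₁)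
    (hp₀ : a₀ % 2 = 0) (hp₁ : a₁ % 2 = 0) : False := by
  omega

/-- **Genus table (arithmetic core of piece rigidity).**  After the pinch each piece is symplectic
with `b₂ = b⁺ = 1`, `b⁻ = 0`, `b₁ = aᵢ ∈ {0, 2}` (parity + Liu 1996 Thm A: `K² = 9 − 4b₁ ≥ 0`),
`a₀ + a₁ = 2g`, and contains the symplectic surface `Bᵢ` of genus `g` and class `m·H`, `m ≥ 1`,
with the SAME `m` on both sides (`H₁(Z) ≅ ℤ^{2g} ⊕ ℤ/m²`).  Adjunction `2g − 2 = B² + K·B` with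
`K ≡ ∓3H` on an `aᵢ = 0` piece (`K² = 9`) and `K ≡ ±H` on an `aᵢ = 2` piece (`K² = 1`) — BOTH
signs allowed, so that no Seiberg–Witten sign information (Liu Thm B) is used.  Conclusion: only
`g = 0` with two `b₁ = 0` pieces (`m = 1` line, `m = 2` conic) or `g = 2` with two `b₁ = 2`
pieces (`m = 1`, or the `K = −H`, `m = 2` ghost which Liu Thm B removes and which is harmless for
the rung's Betti-number conclusion) survive; `g = 1` dies because the two sides demand different
`m` (cubic `m = 3` against `m = 1`). [folklore] -/
theorem genusTable (g m a₀ a₁ : ℕ) (hm : 1 ≤ m) (hsum : a₀ + a₁ = 2 * g)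
    (ha₀ : a₀ = 0 ∨ a₀ = 2) (ha₁ : a₁ = 0 ∨ a₁ = 2)
    (adj₀ : (a₀ = 0 → (2 * g : ℤ) - 2 = m ^ 2 - 3 * m ∨ (2 * g : ℤ) - 2 = m ^ 2 + 3 * m) ∧
            (a₀ = 2 → (2 * g : ℤ) - 2 = m ^ 2 + m ∨ (2 * g : ℤ) - 2 = m ^ 2 - m))
    (adj₁ : (a₁ = 0 → (2 * g : ℤ) - 2 = m ^ 2 - 3 * m ∨ (2 * g : ℤ) - 2 = m ^ 2 + 3 * m) ∧
            (a₁ = 2 → (2 * g : ℤ) - 2 = m ^ 2 + m ∨ (2 * g : ℤ) - 2 = m ^ 2 - m)) :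
    (g = 0 ∧ a₀ = 0 ∧ a₁ = 0 ∧ (m = 1 ∨ m = 2)) ∨ (g = 2 ∧ a₀ = 2 ∧ a₁ = 2 ∧ (m = 1 ∨ m = 2)) := by
  have hg : g ≤ 2 := by omega
  have hm4 : m ≤ 4 := by
    rcases ha₀ with h | h
    · rcases adj₀.1 h with h' | h' <;> nlinarith
    · rcases adj₀.2 h with h' | h' <;> nlinarith
  obtain ⟨A₀, A₀'⟩ := adj₀
  obtain ⟨A₁, A₁'⟩ := adj₁
  interval_cases g <;> interval_cases m <;> omega

/-- **Tightness: the door tuple solves every numerical constraint** (`g = 2`, both pieces with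
`(b₁, b₂) = (2, 1)`, `m = 1`, `K = H = [B]`, `e = 1`, `χ = −1`, `σ = 1`, `K² = 2χ + 3σ = 1`,
adjunction `2 = 1 + 1`, `χ(N₀) + χ(N₁) = −2 = 6 − 4g`, `K² = 9 − 4b₁`).  Hence the escape clause
of the crux cannot be removed by bookkeeping; the natural strengthening "`M ≅ S⁴` outright" is
the rung plus (`NoGenusTwoDoor` or "doors never glue to a homotopy sphere"). [folklore] -/
theorem door_is_solution :
    let g := 2; let m := 1; let b₁ := 2; let b₂ := 1; let χ : ℤ := 2 - 2 * b₁ + b₂; let σ : ℤ := 1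
    χ = -1 ∧ 2 * χ + 3 * σ = (1 : ℤ) ∧ (2 * g : ℤ) - 2 = m ^ 2 + m ∧ χ + χ = 6 - 4 * g ∧
      b₁ + b₁ = 2 * g ∧ (9 : ℤ) - 4 * b₁ = m ^ 2 := by
  decide

/-- Every additive map out of `ℤ/4` is `n ↦ n • f 1`. [folklore] -/
theorem addMonoidHom_zmod4_apply {A : Type*} [AddCommGroup A] (f : ZMod 4 →+ A) (n : ZMod 4) :
    f n = n.val • f 1 := by
  conv_lhs => rw [← ZMod.natCast_zmod_val n]
  rw [← map_nsmul, Nat.smul_one_eq_cast]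

/-- **Small model: the conic fold is not a homology sphere.**  In the `g = 0`, `m = 2` branch
both pieces are (ℂP², conic), `Z = L(4,1)` with `H₁(Z) = ℤ/4`, and `H₁` of each conic complement
is `ℤ/2`; Mayer–Vietoris for `H₁(M) = 0` would need a surjection `ℤ/4 ↠ ℤ/2 ⊕ ℤ/2`, which does
not exist (a cyclic group has cyclic image).  Checked by enumeration. [folklore] -/
theorem conic_case_excluded : ¬ ∃ f : ZMod 4 →+ ZMod 2 × ZMod 2, Function.Surjective f := by
  rintro ⟨f, hf⟩
  have key : ∀ x : ZMod 2 × ZMod 2, ¬ Function.Surjective (fun n : ZMod 4 => n.val • x) := by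
    decide
  refine key (f 1) ?_
  intro y
  obtain ⟨n, rfl⟩ := hf y
  exact ⟨n, (addMonoidHom_zmod4_apply f n).symm⟩

end Summit.SmoothPoincare4.SmoothPoincare4.Theorems.OrigamiRung.Negative
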